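import Summits.CriticalPhenomena.SAWScalingLimit.Theorems.SAWLoopFugacityFlowAvoidanceLimitShieldN
import Summits.CriticalPhenomena.SAWScalingLimit.Theorems.SAWLoopFugacityFlowAvoidanceLimitShieldGoodAbstract
import HarnessLib

/-!
# The shielding lemma with an abstract killed set, northward slit

Sub-problem `CriticalPhenomena/SAWScalingLimit`, crux `AvoidanceLimit`, line `symplectic-fermion-anchor`
(lead c6, §shield, stub W5b). `shield_N_abstract` is the landed shielding lemma `shield_N` (corrected
Chelkak 2016, Lemma 2.14, file `…ShieldN.lean`) with the germ-region data (`b, s, g, o`, `germSites`,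
`germGate`) replaced by an abstract vertex set `Θ ⊆ Ω_δ`: the finiteness of the killed set `S₀ ⊆ Θ`
is now a hypothesis, and the hypothesis that the germ gate misses the maneuver box is replaced by
the closure of `Θ` under the kept edges of `Ω^δ = discreteDomainGraph D.carrier δ` inside the box
`mW c k` (`Θ` has no exits inside the box). This is the form transported under the symmetries of
`ℤ²` to the other lattice orientations.

Statement. Let `H ≥ 0` be killed-harmonic on `S₀ ⊆ Θ` (finite), let `L̂` be the slit (a path of
`Ω^δ` from `x̂₁` up to `p̂`, inside the northward wedge, with exactly one vertical edge at level
`x̂₁₁ + 26k`), let the cap of the maneuver box `mW c k` (`c = x̂₁ + (0, 9k)`) be clean and carry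
the Harnack bound `H ≤ C_H · H p̂`, and let `γ : v₀ → w_end` be a walk on which `H ≥ H v₀`, started
in the germ box `|· - x̂₁| ≤ k` (joined to `x̂₁` inside `|· - x̂₁| ≤ 2k` by `In`) and ending at a
point joined to `p̂` outside the box by `Far`. Then `min (circNcwConst, circNccwConst) · H v₀ ≤ C_H · H p̂`.

Proof: verbatim the proof of `shield_N`, with the certified sites supplied by
`certified_package_abstract` (file `…ShieldGoodAbstract.lean`). If `γ` meets the cap, the Harnack
bound applies at that vertex. Otherwise the closed loop `λ = In · γ · Far · L̂⁻¹` uses the vertical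
slit edge at level `26k` exactly once and no other vertical edge of that level within `24k` of the
slit, so the winding numbers of the two faces beside it differ by one
(`abs_walkWinding_sub_right_of_count_eq_one`) and propagate unchanged along the row to the start
sites `c + (±24k, 17k)` (`walkWinding_row_eq`); the side with nonzero winding gives a certified
start site, the target crossing comes from `aCrossing_N`, the lattice core (`shieldCore_Ncw` /
`shieldCore_Nccw`) bounds the hitting probability of `γ` from below, optional stopping
(`mul_hitProb_le_of_superharmonic`) turns it into `c · H v₀ ≤ H(start)`, and the Harnack bound
finishes.

## References

* D. Chelkak, Robust discrete complex analysis: a toolbox, Ann. Probab. 44 (2016), Lemma 2.14.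
  [Chelkak2016]
-/

noncomputable section

open scoped BigOperators Classical
open Set Complex SimpleGraph Metric
open Literature.Topology.PlaneTopology
open Literature.Probability.Percolation (walkWinding StepKind stepKind_of_adj)
open Literature.Probability.LatticeModels
open Literature.Probability.RandomPlanarGeometry (JordanDomain)

namespace Summit.CriticalPhenomena.SAWScalingLimit.Theorems.AvoidanceLimit.Anchor

/-- **The shielding lemma with an abstract killed set, northward slit.** See the module docstring.
[cite: Chelkak2016, Lemma 2.14] -/
theorem shield_N_abstract :
    ∀ (D : JordanDomain) (δ : ℝ), 0 < δ → ∀ (Θ : Set (Site 2)), Θ ⊆ meshDomain D.carrier δ →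
    ∀ (H : Site 2 → ℝ) (S₀ : Set (Site 2)) (CH : ℝ), S₀ ⊆ Θ → S₀.Finite → (∀ w, 0 ≤ H w) →
      IsKilledHarmonicOn (discreteDomainGraph D.carrier δ) H S₀ →
    ∀ (x₁ pp c : Site 2) (k : ℕ), 5 ≤ k → c 0 = x₁ 0 → c 1 = x₁ 1 + 9 * k → 58 * (k : ℤ) ≤ pp 1 - x₁ 1 →
      (∀ v ∈ Θ, v ∈ mW c k → ∀ e : SRW.Dir 2, (discreteDomainGraph D.carrier δ).Adj v (v + SRW.stepVec e) →
        v + SRW.stepVec e ∈ mW c k → v + SRW.stepVec e ∈ Θ) →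
      (∀ z ∈ Θ, z ∈ mW c k → z ∈ S₀) →
      (∀ w : Site 2, |w 0 - c 0| ≤ 48 * k → |w 1 - c 1| ≤ 48 * k →
        45 * (k : ℤ) ≤ 12 * (w 1 - x₁ 1) - 5 * |w 0 - x₁ 0| →
        w ∈ Θ ∧ ∀ e : SRW.Dir 2, (discreteDomainGraph D.carrier δ).Adj w (w + SRW.stepVec e)) →
      (∀ w : Site 2, |w 0 - c 0| ≤ 48 * k → |w 1 - c 1| ≤ 48 * k →
        45 * (k : ℤ) ≤ 12 * (w 1 - x₁ 1) - 5 * |w 0 - x₁ 0| → H w ≤ CH * H pp) →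
    ∀ (L : (discreteDomainGraph D.carrier δ).Walk x₁ pp), L.IsPath →
      (∀ z ∈ L.support, -1 ≤ z 1 - x₁ 1 ∧ 12 * |z 0 - x₁ 0| ≤ 5 * (z 1 - x₁ 1) + 13) →
      (∃ X₀ : ℤ, s((![X₀, x₁ 1 + 26 * k] : Site 2), ![X₀, x₁ 1 + 26 * k + 1]) ∈ L.edges ∧
        ∀ X : ℤ, s((![X, x₁ 1 + 26 * k] : Site 2), ![X, x₁ 1 + 26 * k + 1]) ∈ L.edges → X = X₀) →
    ∀ (v₀ wend : Site 2) (In : (discreteDomainGraph D.carrier δ).Walk x₁ v₀)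
      (γ : (discreteDomainGraph D.carrier δ).Walk v₀ wend) (Far : (discreteDomainGraph D.carrier δ).Walk wend pp),
      |v₀ 0 - x₁ 0| ≤ k → |v₀ 1 - x₁ 1| ≤ k →
      (∀ z ∈ In.support, |z 0 - x₁ 0| ≤ 2 * k ∧ |z 1 - x₁ 1| ≤ 2 * k) →
      (∀ z ∈ γ.support, z = wend ∨ (z ∈ S₀ ∧ H v₀ ≤ H z)) → H v₀ ≤ H wend →
      (∀ z ∈ Far.support, 48 * (k : ℤ) < |z 0 - c 0| ∨ 48 * (k : ℤ) < |z 1 - c 1|) →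
      min circNcwConst circNccwConst * H v₀ ≤ CH * H pp := by
  intro D δ hδ Θ hΘD H S₀ CH _hS₀Θ hΘfin hH0 hHarm x₁ pp c k hk hc0 hc1 hpp hclosed hΘS₀ hcap hHar L hLpath hLwedge
    hLlevel v₀ wend In γ Far hv00 hv01 hIn hγ hwend hFar
  have hk0 : 0 < k := by omega
  have hle : discreteDomainGraph D.carrier δ ≤ zdGraph 2 :=
    (discreteDomainGraph_le_meshGraph _ _).trans (meshGraph_le_zdGraph _ _)
  have hminpos : 0 < min circNcwConst circNccwConst := lt_min circNcwConst_pos circNccwConst_pos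
  have hmin_le_one : min circNcwConst circNccwConst ≤ 1 := (min_le_left _ _).trans circNcwConst_le_one
  have hm0 : 0 ≤ H v₀ := hH0 v₀
  -- `wend` and every vertex of `Far` lies outside the box
  have hwend_out : 48 * (k : ℤ) < |wend 0 - c 0| ∨ 48 * (k : ℤ) < |wend 1 - c 1| := hFar wend (Walk.start_mem_support Far)
  -- Case 1: `γ` meets the cap
  by_cases hcase : ∃ z ∈ γ.support, |z 0 - c 0| ≤ 48 * k ∧ |z 1 - c 1| ≤ 48 * k ∧
      45 * (k : ℤ) ≤ 12 * (z 1 - x₁ 1) - 5 * |z 0 - x₁ 0|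
  · obtain ⟨z, hzγ, hz0, hz1, hzc⟩ := hcase
    have hzne : z ≠ wend := by
      rintro rfl; rcases hwend_out with h | h <;> omega
    have hHz : H v₀ ≤ H z := by
      rcases hγ z hzγ with h | h
      · exact absurd h hzne
      · exact h.2
    calc min circNcwConst circNccwConst * H v₀ ≤ 1 * H v₀ := mul_le_mul_of_nonneg_right hmin_le_one hm0
      _ = H v₀ := one_mul _
      _ ≤ H z := hHz
      _ ≤ CH * H pp := hHar z hz0 hz1 hzc
  -- Case 2: `γ` avoids the cap inside the box
  push Not at hcase
  -- the closed loop and its winding numbers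
  set lam : (discreteDomainGraph D.carrier δ).Walk x₁ x₁ := (In.append (γ.append Far)).append L.reverse with hlamdef
  set lam' := lam.mapLe hle with hlam'
  have hsupp' : lam'.support = lam.support := Walk.support_mapLe_eq_support hle lam
  have hmem_lam : ∀ t, t ∈ lam.support ↔ t ∈ In.support ∨ t ∈ γ.support ∨ t ∈ Far.support ∨ t ∈ L.support := by
    intro t
    simp only [hlamdef, Walk.mem_support_append_iff, Walk.support_reverse, List.mem_reverse]
    tauto
  -- vertices of `lam` in the box: on `γ`, in the germ box, or in the wedge
  have hvert : ∀ t ∈ lam.support, t ∈ mW c k →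
      t ∈ γ.support ∨ (|t 0 - c 0| ≤ 2 * k ∧ -11 * (k : ℤ) ≤ t 1 - c 1 ∧ t 1 - c 1 ≤ -7 * k) ∨
        (-9 * (k : ℤ) - 1 ≤ t 1 - c 1 ∧ 12 * |t 0 - c 0| ≤ 5 * (t 1 - c 1 + 9 * k) + 13) := by
    intro t ht htW
    have htW' : |t 0 - c 0| ≤ 48 * k ∧ |t 1 - c 1| ≤ 48 * k := by simpa [mW] using htW
    rcases (hmem_lam t).1 ht with h | h | h | h
    · right; left
      obtain ⟨h0, h1⟩ := hIn t h
      rw [abs_le] at h0 h1 ⊢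
      refine ⟨⟨by omega, by omega⟩, by omega, by omega⟩
    · exact Or.inl h
    · rcases hFar t h with h' | h' <;> omega
    · right; right
      obtain ⟨h1, h2⟩ := hLwedge t h
      rw [hc0, hc1]
      exact ⟨by omega, by simpa [add_sub_cancel, sub_add_cancel] using (by omega : 12 * |t 0 - x₁ 0| ≤ 5 * (t 1 - (x₁ 1 + 9 * k) + 9 * k) + 13)⟩
  -- all vertices of `lam` are sites of `Ω_δ`
  have hx₁D : x₁ ∈ meshDomain D.carrier δ := by
    have hne : x₁ ≠ pp := by
      intro h; have := hpp; rw [← h] at this; omega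
    cases L with
    | nil => exact absurd rfl hne
    | cons h p => exact (discreteDomainGraph_adj_iff.1 h).2.1
  have hlamD : ∀ t ∈ lam.support, t ∈ meshDomain D.carrier δ :=
    mem_meshDomain_of_mem_support' lam hx₁D
  -- the level `Y₀` of the slit edge used for the jump
  set Y₀ : ℤ := x₁ 1 + 26 * k with hY₀
  obtain ⟨X₀, hX₀mem, hX₀uniq⟩ := hLlevel
  -- vertical edges at level `Y₀` within `24k+1` of the slit are edges of `lam` iff they are the slit edge
  have hX₀bd : |X₀ - x₁ 0| ≤ 11 * k + 2 := by
    have hv := hLwedge _ (Walk.fst_mem_support_of_mem_edges L hX₀mem)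
    simp only [Matrix.cons_val_zero, Matrix.cons_val_one] at hv
    have h2 := hv.2
    have ha := le_abs_self (X₀ - x₁ 0)
    have hb := neg_abs_le (X₀ - x₁ 0)
    rw [hY₀] at h2
    rw [abs_le]
    constructor <;> omega
  have hcapY : ∀ X : ℤ, |X - x₁ 0| ≤ 25 * k →
      45 * (k : ℤ) ≤ 12 * ((![X, Y₀] : Site 2) 1 - x₁ 1) - 5 * |(![X, Y₀] : Site 2) 0 - x₁ 0| := by
    intro X hX
    simp only [Matrix.cons_val_zero, Matrix.cons_val_one, hY₀]
    rw [abs_le] at hX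
    rcases abs_cases (X - x₁ 0) with ⟨h, _⟩ | ⟨h, _⟩ <;> rw [h] <;> omega
  have hcapY1 : ∀ X : ℤ, |X - x₁ 0| ≤ 25 * k →
      45 * (k : ℤ) ≤ 12 * ((![X, Y₀ + 1] : Site 2) 1 - x₁ 1) - 5 * |(![X, Y₀ + 1] : Site 2) 0 - x₁ 0| := by
    intro X hX
    simp only [Matrix.cons_val_zero, Matrix.cons_val_one, hY₀]
    rw [abs_le] at hX
    rcases abs_cases (X - x₁ 0) with ⟨h, _⟩ | ⟨h, _⟩ <;> rw [h] <;> omega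
  have hboxY : ∀ X : ℤ, |X - x₁ 0| ≤ 25 * k → (![X, Y₀] : Site 2) ∈ mW c k ∧ (![X, Y₀ + 1] : Site 2) ∈ mW c k := by
    intro X hX
    simp only [mW, mem_setOf_eq, Matrix.cons_val_zero, Matrix.cons_val_one, hY₀, hc0, hc1]
    rw [abs_le] at hX
    refine ⟨⟨by rw [abs_le]; constructor <;> omega, by rw [abs_le]; constructor <;> omega⟩,
      by rw [abs_le]; constructor <;> omega, by rw [abs_le]; constructor <;> omega⟩
  -- a cap site of the box is not a vertex of `In`, `γ`, `Far`
  have hnotIn : ∀ t : Site 2, 45 * (k : ℤ) ≤ 12 * (t 1 - x₁ 1) - 5 * |t 0 - x₁ 0| → t ∉ In.support := by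
    intro t ht hmem
    obtain ⟨h0, h1⟩ := hIn t hmem
    rw [abs_le] at h1
    have := abs_nonneg (t 0 - x₁ 0)
    omega
  have hnotγ : ∀ t : Site 2, t ∈ mW c k → 45 * (k : ℤ) ≤ 12 * (t 1 - x₁ 1) - 5 * |t 0 - x₁ 0| → t ∉ γ.support := by
    intro t htW ht hmem
    have htW' : |t 0 - c 0| ≤ 48 * k ∧ |t 1 - c 1| ≤ 48 * k := by simpa [mW] using htW
    have := hcase t hmem htW'.1 htW'.2
    omega
  have hnotFar : ∀ t : Site 2, t ∈ mW c k → t ∉ Far.support := by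
    intro t htW hmem
    have htW' : |t 0 - c 0| ≤ 48 * k ∧ |t 1 - c 1| ≤ 48 * k := by simpa [mW] using htW
    rcases hFar t hmem with h | h <;> omega
  -- the edges of `lam`
  have hedges : lam.edges = In.edges ++ (γ.edges ++ Far.edges) ++ L.edges.reverse := by
    simp only [hlamdef, Walk.edges_append, Walk.edges_reverse]
  have hvedge : ∀ X : ℤ, |X - x₁ 0| ≤ 25 * k →
      (s((![X, Y₀] : Site 2), ![X, Y₀ + 1]) ∈ In.edges → False) ∧
      (s((![X, Y₀] : Site 2), ![X, Y₀ + 1]) ∈ γ.edges → False) ∧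
      (s((![X, Y₀] : Site 2), ![X, Y₀ + 1]) ∈ Far.edges → False) := by
    intro X hX
    refine ⟨fun h => ?_, fun h => ?_, fun h => ?_⟩
    · exact hnotIn _ (hcapY X hX) (Walk.fst_mem_support_of_mem_edges In h)
    · exact hnotγ _ (hboxY X hX).1 (hcapY X hX) (Walk.fst_mem_support_of_mem_edges γ h)
    · exact hnotFar _ (hboxY X hX).1 (Walk.fst_mem_support_of_mem_edges Far h)
  -- the slit edge is used exactly once by `lam'`
  have hcount : lam'.edges.count s((![X₀, Y₀] : Site 2), ![X₀, Y₀ + 1]) = 1 := by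
    rw [hlam', Walk.edges_mapLe_eq_edges, hedges]
    have hX : |X₀ - x₁ 0| ≤ 25 * k := by rw [abs_le] at hX₀bd ⊢; constructor <;> omega
    obtain ⟨h1, h2, h3⟩ := hvedge X₀ hX
    rw [List.count_append, List.count_append, List.count_append, List.count_reverse,
      List.count_eq_zero.2 (fun h => h1 h), List.count_eq_zero.2 (fun h => h2 h), List.count_eq_zero.2 (fun h => h3 h),
      List.count_eq_one_of_mem (Walk.edges_nodup_of_support_nodup hLpath.support_nodup) hX₀mem]
  -- the other vertical edges of the level near the slit are not edges of `lam'`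
  have hnoedge : ∀ X : ℤ, |X - x₁ 0| ≤ 25 * k → X ≠ X₀ →
      s((![X, Y₀] : Site 2), ![X, Y₀ + 1]) ∉ lam'.edges := by
    intro X hX hXne h
    rw [hlam', Walk.edges_mapLe_eq_edges, hedges, List.mem_append, List.mem_append, List.mem_append,
      List.mem_reverse] at h
    obtain ⟨h1, h2, h3⟩ := hvedge X hX
    rcases h with (h | h | h) | h
    · exact h1 h
    · exact h2 h
    · exact h3 h
    · exact hXne (hX₀uniq X h)
  -- the jump across the slit edge: faces `![X₀ - 1, Y₀]` and `![X₀, Y₀]`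
  have hjump : |walkWinding lam' ![X₀ - 1, Y₀] - walkWinding lam' ![X₀, Y₀]| = 1 := by
    have e1 : (![X₀ - 1, Y₀] : Site 2) + Pi.single 0 1 = ![X₀, Y₀] := by
      ext i; fin_cases i <;> simp [sub_add_cancel]
    have e2 : (![X₀, Y₀] : Site 2) + Pi.single 1 1 = ![X₀, Y₀ + 1] := by
      ext i; fin_cases i <;> simp
    have key := abs_walkWinding_sub_right_of_count_eq_one lam' ![X₀ - 1, Y₀] (by rw [e1, e2]; exact hcount)
    rwa [e1] at key
  -- propagation along the row to the two start sites
  have hrowR : walkWinding lam' ![X₀, Y₀] = walkWinding lam' ![x₁ 0 + 24 * k, Y₀] := by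
    have hn : (x₁ 0 + 24 * k - X₀).toNat = x₁ 0 + 24 * k - X₀ := Int.toNat_of_nonneg (by rw [abs_le] at hX₀bd; omega)
    have key := walkWinding_row_eq lam' X₀ Y₀ (x₁ 0 + 24 * k - X₀).toNat (fun j hj hjn => by
      apply hnoedge
      · rw [abs_le] at hX₀bd ⊢; constructor <;> omega
      · omega)
    rw [hn, add_sub_cancel] at key
    exact key
  have hrowL : walkWinding lam' ![x₁ 0 - 24 * k, Y₀] = walkWinding lam' ![X₀ - 1, Y₀] := by
    have hn : (X₀ - 1 - (x₁ 0 - 24 * k)).toNat = X₀ - 1 - (x₁ 0 - 24 * k) :=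
      Int.toNat_of_nonneg (by rw [abs_le] at hX₀bd; omega)
    have key := walkWinding_row_eq lam' (x₁ 0 - 24 * k) Y₀ (X₀ - 1 - (x₁ 0 - 24 * k)).toNat (fun j hj hjn => by
      apply hnoedge
      · rw [abs_le] at hX₀bd ⊢; constructor <;> omega
      · omega)
    rw [hn, add_sub_cancel] at key
    exact key
  -- one of the two start sites has nonzero winding number
  have hstart : ∃ u : Site 2, walkWinding lam' u ≠ 0 ∧ u 1 = Y₀ ∧ (u 0 = x₁ 0 + 24 * k ∨ u 0 = x₁ 0 - 24 * k) := by
    by_cases hR : walkWinding lam' ![x₁ 0 + 24 * k, Y₀] ≠ 0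
    · exact ⟨_, hR, by simp, Or.inl (by simp)⟩
    · push Not at hR
      refine ⟨![x₁ 0 - 24 * k, Y₀], ?_, by simp, Or.inr (by simp)⟩
      rw [hrowL]
      intro h0
      rw [hrowR, hR, h0] at hjump
      simp at hjump
  obtain ⟨u, huw, hu1, hu0⟩ := hstart
  -- the start site is a clean cap site of the box, off the loop
  have hu0bd : |u 0 - x₁ 0| = 24 * k := by
    rcases hu0 with h | h <;> rw [h] <;> simp [abs_of_nonneg, show (0 : ℤ) ≤ 24 * k by positivity]
  have hucap : 45 * (k : ℤ) ≤ 12 * (u 1 - x₁ 1) - 5 * |u 0 - x₁ 0| := by rw [hu1, hu0bd, hY₀]; omega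
  have huc0 : |u 0 - c 0| ≤ 48 * k := by
    rw [hc0]; rcases hu0 with h | h <;> rw [h, abs_le] <;> constructor <;> omega
  have huc1 : |u 1 - c 1| ≤ 48 * k := by rw [hu1, hc1, hY₀, abs_le]; constructor <;> omega
  have huW : u ∈ mW c k := by simp only [mW, mem_setOf_eq]; exact ⟨huc0, huc1⟩
  obtain ⟨huΘ, huadj⟩ := hcap u huc0 huc1 hucap
  have hunot : u ∉ lam.support := by
    intro h
    rcases hvert u h huW with h' | h' | h'
    · exact hnotγ u huW hucap h'
    · obtain ⟨_, _, h3⟩ := h'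
      rw [hu1, hc1, hY₀] at h3; omega
    · obtain ⟨_, h2⟩ := h'
      rw [hc0, hu1, hc1, hY₀, hu0bd] at h2; omega
  have hunot' : u ∉ lam'.support := by rwa [hsupp']
  -- the certified sites
  obtain ⟨S, hSin, hSΘ, hSW, hSnot, hSadj, hScl⟩ := certified_package_abstract D δ hδ Θ hΘD lam c k hlamD hclosed
  have huS : u ∈ S := hSin u hunot huw huW huΘ
  -- the target set and its crossing
  set A : Set (Site 2) := {z | z ∈ (γ.mapLe hle).support} with hA
  have hAγ : ∀ z, z ∈ A ↔ z ∈ γ.support := fun z => by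
    rw [hA, mem_setOf_eq, Walk.support_mapLe_eq_support]
  have hcross := aCrossing_N c x₁ k hk0 hc0 hc1 (γ.mapLe hle) hv00 hv01 hwend_out (fun z hz hz0 hz1 => by
    rw [Walk.support_mapLe_eq_support] at hz
    exact hcase z hz hz0 hz1)
  -- hypotheses of the lattice core
  have hSA : Disjoint S A := by
    rw [Set.disjoint_left]
    intro v hv hvA
    exact hSnot v hv ((hmem_lam v).2 (Or.inr (Or.inl ((hAγ v).1 hvA))))
  have hSS₀ : S ⊆ S₀ := fun v hv => hΘS₀ v (hSΘ hv) (hSW hv)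
  have hcl : ∀ v ∈ S, ∀ kk : Fin 4, v + cornerUnit kk ∈ mW c k →
      v + cornerUnit kk ∈ S ∨ v + cornerUnit kk ∈ A ∨
        (|(v + cornerUnit kk) 0 - c 0| ≤ 2 * k ∧ -11 * (k : ℤ) ≤ (v + cornerUnit kk) 1 - c 1 ∧
            (v + cornerUnit kk) 1 - c 1 ≤ -7 * k) ∨
        (-9 * (k : ℤ) - 1 ≤ (v + cornerUnit kk) 1 - c 1 ∧
            12 * |(v + cornerUnit kk) 0 - c 0| ≤ 5 * ((v + cornerUnit kk) 1 - c 1 + 9 * k) + 13) := by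
    intro v hv kk hwW
    rcases hScl v hv kk hwW with h | h
    · exact Or.inl h
    · rcases hvert _ h hwW with h' | h' | h'
      · exact Or.inr (Or.inl ((hAγ _).2 h'))
      · exact Or.inr (Or.inr (Or.inl h'))
      · exact Or.inr (Or.inr (Or.inr h'))
  -- the hitting probability of `A` from `u` is at least the circuit constant of the matching side
  have hhit : min circNcwConst circNccwConst ≤ hitProb (discreteDomainGraph D.carrier δ) S₀ A u := by
    rcases hu0 with h0 | h0
    · refine (min_le_left _ _).trans ?_
      exact shieldCore_Ncw (discreteDomainGraph D.carrier δ) S₀ A S c k hk hΘfin hSA hSS₀ hSW hSadj hcl hcross u huS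
        (by rw [h0, hc0]; omega) (by rw [h0, hc0]; omega) (by rw [hu1, hc1, hY₀]; omega) (by rw [hu1, hc1, hY₀]; omega)
    · refine (min_le_right _ _).trans ?_
      exact shieldCore_Nccw (discreteDomainGraph D.carrier δ) S₀ A S c k hk hΘfin hSA hSS₀ hSW hSadj hcl hcross u huS
        (by rw [h0, hc0]; omega) (by rw [h0, hc0]; omega) (by rw [hu1, hc1, hY₀]; omega) (by rw [hu1, hc1, hY₀]; omega)
  -- optional stopping: `H v₀ · P[hit A] ≤ H u`
  have hsuper : IsKilledSuperharmonicOn (discreteDomainGraph D.carrier δ) H (S₀ \ A) :=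
    (hHarm.mono fun x hx => hx.1).superharmonicOn
  have hAval : ∀ w ∈ A, H v₀ ≤ H w := by
    intro w hw
    rcases hγ w ((hAγ w).1 hw) with h | h
    · rw [h]; exact hwend
    · exact h.2
  have hstop := mul_hitProb_le_of_superharmonic (discreteDomainGraph D.carrier δ) S₀ A H (H v₀) hΘfin hm0 hH0 hsuper hAval u
  calc min circNcwConst circNccwConst * H v₀ ≤ hitProb (discreteDomainGraph D.carrier δ) S₀ A u * H v₀ :=
        mul_le_mul_of_nonneg_right hhit hm0
    _ = H v₀ * hitProb (discreteDomainGraph D.carrier δ) S₀ A u := mul_comm _ _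
    _ ≤ H u := hstop
    _ ≤ CH * H pp := hHar u huc0 huc1 hucap

end Summit.CriticalPhenomena.SAWScalingLimit.Theorems.AvoidanceLimit.Anchor

end
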